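import Literature.Probability.Percolation.ArmSeparationSepInit
import HarnessLib

/-!
# The initial estimate of the separation scheme at ratio up to `10`

Topic: Probability / Percolation; family `crit-perc`. A brick of the discharge of
`Literature.Probability.Percolation.Nolin2008_twoArm_separation` (Nolin 2008, Thm. 11
[arXiv 0711.4948: Thm. 10]; `ArmSeparation.lean`). `ArmSeparationSepInit` proves
`P(sepTwoArm m N) ≥ c_init` for `2m ≤ N ≤ 5m`; the dyadic ladder of the scheme needs a rung `ρ`
with `4ρ + 2 ≤ N ≤ A ρ`, which always exists only for `A ≥ 8`. This file reruns the same
explicit five-crossing construction (`sepInitArm`) with RSW at aspect ratio `1024` instead of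
`512`, which covers `2m ≤ N ≤ 10m` (`le_real_sepInitArm_wide`, `sq_le_real_sepTwoArm_wide`,
`exists_le_real_sepTwoArm_wide`).

## References

* P. Nolin, *Near-critical percolation in two dimensions*, Electron. J. Probab. 13 (2008), §4.3
  Prop. 14, §4.4 [arXiv 0711.4948: Prop. 13]. [Nolin2008]
-/

noncomputable section

open MeasureTheory Set

namespace Literature.Probability.Percolation

open LatticeModels

/-- **RSW and Harris for the explicit arm, wide ratio**: if `c ≤ P_{1/2}(long-way crossing of
[0, 1024 n] × [0, n])` for all `n ≥ 1` (`c ≥ 0`), then `P(sepInitArm m N) ≥ c⁵` for `1100 ≤ m`,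
`2m ≤ N ≤ 10m`. [cite: Nolin2008, §4.3 Prop. 14 (arXiv 0711.4948: Prop. 13)] -/
theorem le_real_sepInitArm_wide {c : ℝ} (hrsw : ∀ n : ℕ, 1 ≤ ⌊(1024 : ℝ) * n⌋₊ → c ≤ triLRCrossingProb half ⌊(1024 : ℝ) * n⌋₊ n)
    (hc : 0 ≤ c) {m N : ℕ} (hm : 1100 ≤ m) (hmN : 2 * m ≤ N) (hN : N ≤ 10 * m) :
    c ^ 5 ≤ (triSitePercolation half).real (sepInitArm m N) := by
  have hfl : ∀ n : ℕ, ⌊(1024 : ℝ) * (n : ℕ)⌋₊ = 1024 * n := fun n => by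
    have : (1024 : ℝ) * (n : ℕ) = ((1024 * n : ℕ) : ℝ) := by push_cast; ring
    rw [this, Nat.floor_natCast]
  have hcw : ∀ L n : ℕ, 1 ≤ n → L ≤ 1024 * n → c ≤ triLRCrossingProb half L n := fun L n hn hL => by
    have h := hrsw n (by rw [hfl]; omega)
    rw [hfl] at h
    exact h.trans (triLRCrossingProb_anti_width half hL n)
  set F := sepInitArmFinset m N with hF
  set E1 := triVCross ((m : ℤ) - (m / 8 : ℕ) + 1) (-((m / 2 : ℕ) : ℤ) - (m / 64 : ℕ)) (m / 8 - 2) (2 * (m / 64)) with hE1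
  set E2 := triHCross ((m : ℤ) - (m / 8 : ℕ) + 1) (-((m / 2 : ℕ) : ℤ)) (N - m + m / 8 - 2) (m / 64) with hE2
  set E3 := triVCross ((N : ℤ) - (N / 8 : ℕ)) (-((N / 2 : ℕ) : ℤ) - (N / 64 : ℕ)) (N / 8 - 1) (N / 2 + N / 64 - m / 2 + m / 64) with hE3
  set E4 := triHCross ((N : ℤ) - (N / 8 : ℕ)) (-((N / 2 : ℕ) : ℤ) - (N / 64 : ℕ) + 1) (2 * (N / 8) - 1) (N / 64 - 1) with hE4
  set E5 := triVCross ((N : ℤ) + 2) (-((N / 2 : ℕ) : ℤ) - (N / 64 : ℕ)) (N / 8 - 3) (2 * (N / 64)) with hE5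
  have c1 : (↑(triStripFinset ((m : ℤ) - (m / 8 : ℕ) + 1) (-((m / 2 : ℕ) : ℤ) - (m / 64 : ℕ)) (m / 8 - 2) (2 * (m / 64))) : Set (Site 2)) ⊆ ↑F :=
    Finset.coe_subset.2 (Finset.subset_union_left.trans (Finset.subset_union_left.trans
      (Finset.subset_union_left.trans Finset.subset_union_left)))
  have c2 : (↑(triStripFinset ((m : ℤ) - (m / 8 : ℕ) + 1) (-((m / 2 : ℕ) : ℤ)) (N - m + m / 8 - 2) (m / 64)) : Set (Site 2)) ⊆ ↑F :=
    Finset.coe_subset.2 (Finset.subset_union_right.trans (Finset.subset_union_left.trans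
      (Finset.subset_union_left.trans Finset.subset_union_left)))
  have c3 : (↑(triStripFinset ((N : ℤ) - (N / 8 : ℕ)) (-((N / 2 : ℕ) : ℤ) - (N / 64 : ℕ)) (N / 8 - 1) (N / 2 + N / 64 - m / 2 + m / 64)) :
      Set (Site 2)) ⊆ ↑F :=
    Finset.coe_subset.2 (Finset.subset_union_right.trans (Finset.subset_union_left.trans Finset.subset_union_left))
  have c4 : (↑(triStripFinset ((N : ℤ) - (N / 8 : ℕ)) (-((N / 2 : ℕ) : ℤ) - (N / 64 : ℕ) + 1) (2 * (N / 8) - 1) (N / 64 - 1)) : Set (Site 2)) ⊆ ↑F :=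
    Finset.coe_subset.2 (Finset.subset_union_right.trans Finset.subset_union_left)
  have c5 : (↑(triStripFinset ((N : ℤ) + 2) (-((N / 2 : ℕ) : ℤ) - (N / 64 : ℕ)) (N / 8 - 3) (2 * (N / 64))) : Set (Site 2)) ⊆ ↑F :=
    Finset.coe_subset.2 Finset.subset_union_right
  have d1 : DeterminedBy E1 ↑F := (determinedBy_triVCross _ _ _ _).mono c1
  have d2 : DeterminedBy E2 ↑F := (determinedBy_triHCross _ _ _ _).mono c2
  have d3 : DeterminedBy E3 ↑F := (determinedBy_triVCross _ _ _ _).mono c3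
  have d4 : DeterminedBy E4 ↑F := (determinedBy_triHCross _ _ _ _).mono c4
  have d5 : DeterminedBy E5 ↑F := (determinedBy_triVCross _ _ _ _).mono c5
  have u1 : IsUpperSet E1 := isUpperSet_triVCross _ _ _ _
  have u2 : IsUpperSet E2 := isUpperSet_triHCross _ _ _ _
  have u3 : IsUpperSet E3 := isUpperSet_triVCross _ _ _ _
  have u4 : IsUpperSet E4 := isUpperSet_triHCross _ _ _ _
  have u5 : IsUpperSet E5 := isUpperSet_triVCross _ _ _ _
  have e1 : c ≤ (triSitePercolation half).real E1 := by
    rw [hE1, triSitePercolation_real_triVCross]; exact hcw _ _ (by omega) (by omega)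
  have e2 : c ≤ (triSitePercolation half).real E2 := by
    rw [hE2, triSitePercolation_real_triHCross]; exact hcw _ _ (by omega) (by omega)
  have e3 : c ≤ (triSitePercolation half).real E3 := by
    rw [hE3, triSitePercolation_real_triVCross]; exact hcw _ _ (by omega) (by omega)
  have e4 : c ≤ (triSitePercolation half).real E4 := by
    rw [hE4, triSitePercolation_real_triHCross]; exact hcw _ _ (by omega) (by omega)
  have e5 : c ≤ (triSitePercolation half).real E5 := by
    rw [hE5, triSitePercolation_real_triVCross]; exact hcw _ _ (by omega) (by omega)
  have h12 := sitePercolation_harris half d1 d2 u1 u2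
  have h123 := sitePercolation_harris half (d1.inter d2) d3 (u1.inter u2) u3
  have h1234 := sitePercolation_harris half ((d1.inter d2).inter d3) d4 ((u1.inter u2).inter u3) u4
  have h12345 := sitePercolation_harris half (((d1.inter d2).inter d3).inter d4) d5 (((u1.inter u2).inter u3).inter u4) u5
  have hdef : sepInitArm m N = E1 ∩ E2 ∩ E3 ∩ E4 ∩ E5 := rfl
  unfold triSitePercolation at e1 e2 e3 e4 e5 ⊢
  rw [hdef]
  set μ := sitePercolation (Site 2) half with hμ
  have h0 : ∀ s, 0 ≤ μ.real s := fun s => measureReal_nonneg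
  calc c ^ 5 = c * c * c * c * c := by ring
    _ ≤ μ.real E1 * μ.real E2 * μ.real E3 * μ.real E4 * μ.real E5 := by
        have := mul_le_mul e1 e2 hc (h0 _)
        have := mul_le_mul this e3 hc (mul_nonneg (h0 _) (h0 _))
        have := mul_le_mul this e4 hc (mul_nonneg (mul_nonneg (h0 _) (h0 _)) (h0 _))
        exact mul_le_mul this e5 hc (mul_nonneg (mul_nonneg (mul_nonneg (h0 _) (h0 _)) (h0 _)) (h0 _))
    _ ≤ μ.real (E1 ∩ E2) * μ.real E3 * μ.real E4 * μ.real E5 :=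
        mul_le_mul_of_nonneg_right (mul_le_mul_of_nonneg_right (mul_le_mul_of_nonneg_right h12 (h0 _)) (h0 _)) (h0 _)
    _ ≤ μ.real (E1 ∩ E2 ∩ E3) * μ.real E4 * μ.real E5 :=
        mul_le_mul_of_nonneg_right (mul_le_mul_of_nonneg_right h123 (h0 _)) (h0 _)
    _ ≤ μ.real (E1 ∩ E2 ∩ E3 ∩ E4) * μ.real E5 := mul_le_mul_of_nonneg_right h1234 (h0 _)
    _ ≤ μ.real (E1 ∩ E2 ∩ E3 ∩ E4 ∩ E5) := h12345

/-- **The landed two-arm event at ratio up to `10`**: `P(sepTwoArm m N) ≥ (c⁵)²` for `1100 ≤ m`,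
`2m ≤ N ≤ 10m`. [cite: Nolin2008, §4.3 Prop. 14 (arXiv 0711.4948: Prop. 13)] -/
theorem sq_le_real_sepTwoArm_wide {c : ℝ} (hrsw : ∀ n : ℕ, 1 ≤ ⌊(1024 : ℝ) * n⌋₊ → c ≤ triLRCrossingProb half ⌊(1024 : ℝ) * n⌋₊ n)
    (hc : 0 ≤ c) {m N : ℕ} (hm : 1100 ≤ m) (hmN : 2 * m ≤ N) (hN : N ≤ 10 * m) :
    (c ^ 5) ^ 2 ≤ (triSitePercolation half).real (sepTwoArm m N) := by
  classical
  have d := determinedBy_sepInitArm m N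
  have d' : DeterminedBy (negFlip ⁻¹' sepInitArm m N) ↑((sepInitArmFinset m N).image (fun v : Site 2 => -v)) := by
    refine d.preimage_negFlip.mono ?_
    intro v hv
    rw [Finset.coe_image]
    exact ⟨-v, hv, neg_neg v⟩
  have hdisj : Disjoint (sepInitArmFinset m N) ((sepInitArmFinset m N).image (fun v : Site 2 => -v)) := by
    rw [Finset.disjoint_left]
    intro v hv hv'
    rw [Finset.mem_image] at hv'
    obtain ⟨w, hw, rfl⟩ := hv'
    have h1 := sepInitArmFinset_pos (by omega) hmN hv
    have h2 := sepInitArmFinset_pos (by omega) hmN hw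
    simp only [Pi.neg_apply] at h1
    omega
  have hind := sitePercolation_real_inter_of_disjoint half d d' hdisj
  have hneg := triSitePercolation_real_preimage_negFlip (sepInitArm m N)
  have h5 := le_real_sepInitArm_wide hrsw hc hm hmN hN
  unfold triSitePercolation at hind hneg h5 ⊢
  calc (c ^ 5) ^ 2 = c ^ 5 * c ^ 5 := sq _
    _ ≤ (sitePercolation (Site 2) half).real (sepInitArm m N) * (sitePercolation (Site 2) half).real (negFlip ⁻¹' sepInitArm m N) := by
        rw [hneg]; exact mul_le_mul h5 h5 (pow_nonneg hc _) measureReal_nonneg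
    _ = (sitePercolation (Site 2) half).real (sepInitArm m N ∩ negFlip ⁻¹' sepInitArm m N) := hind.symm
    _ ≤ (sitePercolation (Site 2) half).real (sepTwoArm m N) :=
        measureReal_mono (sepInitArm_inter_subset_sepTwoArm hm hmN) (measure_ne_top _ _)

/-- **The initial estimate of the scheme, wide ratio**: there is `c_init > 0` with
`P(sepTwoArm m N) ≥ c_init` for all `1100 ≤ m`, `2m ≤ N ≤ 10m`. [cite: Nolin2008, §4.3 Prop. 14 (arXiv 0711.4948: Prop. 13); §4.4 (proof of Thm. 11)] -/
theorem exists_le_real_sepTwoArm_wide :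
    ∃ c : ℝ, 0 < c ∧ ∀ m N : ℕ, 1100 ≤ m → 2 * m ≤ N → N ≤ 10 * m → c ≤ (triSitePercolation half).real (sepTwoArm m N) := by
  obtain ⟨c, hc, hrsw⟩ := tri_rsw_half_holds 1024 (by norm_num)
  exact ⟨(c ^ 5) ^ 2, by positivity, fun m N hm hmN hN => sq_le_real_sepTwoArm_wide (fun n hn => (hrsw n hn).1) hc.le hm hmN hN⟩

end Literature.Probability.Percolation
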